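import Mathlib.Combinatorics.SimpleGraph.Walk.Counting
import Mathlib.Analysis.SpecialFunctions.Pow.Real
import Literature.Probability.LatticeModels.LatticeGraph
import Literature.Probability.LatticeModels.ThermodynamicLimit
import HarnessLib

/-!
# Non-intersection of two planar simple random walks up to constants (exponent `5/8`)

Topic `Literature/Probability/RandomPlanarGeometry`. One NAMED FACT filed by a grounder for route
`CriticalPhenomena/SAWScalingLimit/SAWCutPointCondensation` (crux `FreeEnergyScaling`,
item `stmt-CriticalPhenomena-7350`; also the calibration input of crux `CutPointWindowLimit`,
item `stmt-CriticalPhenomena-7349`): the planar random-walk intersection exponent is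
`ζ₂ = 5/8` WITH ESTIMATES UP TO MULTIPLICATIVE CONSTANTS. This is the printed input behind the
route's numbers "P(j is a cut time) ≍ n^{-5/8}, E #cut times ≍ n^{3/8}, dim(Brownian cut points)
= 2 - 2ζ₂ = 3/4" (the relevance exponent `y = 3/4`, window `δ^{3/4}`, `8/3 = 2/y`).

## Sources (read: arXiv:math/0003156 pp. 2–3; EJP 1:13 pp. 2–3)

* G. F. Lawler, O. Schramm, W. Werner, *Values of Brownian intersection exponents, II: Plane
  exponents*, Acta Math. **187** (2001) 275–308 [LawlerSchrammWerner2001PlaneExponents]: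
  Theorem 1: `ζ_n = (4n² - 1)/24` for all `n ≥ 2` (so `ζ₂ = 5/8`); §1, the display following
  Theorem 1: "It was shown in [BL1] that the exponent `ζ₂` equals the corresponding exponent for
  simple random walks (see also [CM]). This result was sharpened in [Lwalkcut, LP], where
  estimates were derived up to multiplicative constants. It follows from these results and
  Theorem 1 that if `S` and `S'` denote two independent simple random walks started from
  neighboring vertices in `ℤ²`, then for some constant `c > 0`,
  `c⁻¹ k^{-5/8} ≤ P[S[0,k] ∩ S'[0,k] = ∅] ≤ c k^{-5/8}` for all `k ≥ 1`."; Corollary 3: the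
  set of cut-points of `B[0,1]` has Hausdorff dimension `3/4` a.s.
* G. F. Lawler, *Cut times for simple random walk*, Electron. J. Probab. **1** (1996), paper 13
  [Lawler1996CutTimes]: Theorem 1.3 (the random-walk non-intersection probability equals
  `n^{-ζ}` up to multiplicative constants, `d = 2, 3`), Theorems 1.1–1.2 (moment estimates for
  the number `R_n` of cut times `j ≤ n` of `S[0,n]`, `R_n ≍ n^{1-ζ}`).

## Transposition (design note)

`P[S[0,k] ∩ S'[0,k] = ∅]` for independent simple random walks from the neighbouring vertices
`0` and `e₁ = (1,0)` of `ℤ²` is the number of ordered pairs `(ω, ω')` of `k`-step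
nearest-neighbour walks of `zdGraph 2`, `ω` from `0`, `ω'` from `e₁`, whose vertex sets
`{ω₀,…,ω_k}`, `{ω'₀,…,ω'_k}` are disjoint, divided by `4^k · 4^k = 16^k` (uniform measure on
`k`-step walks; endpoints of such walks lie in the boxes `{-k,…,k}²`, `{-(k+1),…,k+1}²`, so the
endpoint sums below are exhaustive, as in `BlobTime.partitionSum` / `SAW.Zd.count`). By the
symmetries of `ℤ²` the choice of the neighbouring pair is immaterial. Nothing else is transposed;
the Brownian statements (Theorem 1 itself, Corollary 3) are not typed here (no planar Brownian
intersection-exponent vocabulary in the tree). Users take `(h : LSW2001_srw_nonIntersection_five_eighths)`.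

Mathlib: `SimpleGraph.finsetWalkLength`, `SimpleGraph.Walk.support`, `Real.rpow`. Tree: `Site`,
`zdGraph` (LatticeGraph.lean), `box` (ThermodynamicLimit.lean). Searched the tree for an existing
statement (`nonintersect`, `IntersectionExponent`, `5 / 8` with walks): none.
-/

noncomputable section

open Finset SimpleGraph Literature.Probability.LatticeModels
open scoped BigOperators

namespace Literature.Probability.RandomPlanarGeometry

namespace PlaneNonIntersection

/-- The lattice neighbour `e₁ = (1, 0)` of the origin of `ℤ²`. [folklore] -/
def e₁ : Site 2 := ![1, 0]

open scoped Classical in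
/-- **Number of non-intersecting pairs**: ordered pairs `(ω, ω')` of `k`-step nearest-neighbour
walks on `ℤ²`, `ω` from `0` and `ω'` from `e₁ = (1,0)`, with DISJOINT vertex sets
`{ω₀, …, ω_k} ∩ {ω'₀, …, ω'_k} = ∅` (LSW's event `S[0,k] ∩ S'[0,k] = ∅`); endpoints summed over
the exhaustive boxes `{-k,…,k}²` and `{-(k+1),…,k+1}²`.
[cite: LawlerSchrammWerner2001PlaneExponents, §1 (display after Thm 1)] -/
def nonIntersectingPairs (k : ℕ) : ℕ :=
  ∑ v ∈ box 2 k, ∑ w ∈ box 2 (k + 1),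
    ∑ p ∈ (zdGraph 2).finsetWalkLength k (0 : Site 2) v,
      ∑ q ∈ (zdGraph 2).finsetWalkLength k e₁ w,
        if Disjoint p.support.toFinset q.support.toFinset then 1 else 0

end PlaneNonIntersection

open PlaneNonIntersection in
/-- NAMED FACT — **Lawler–Schramm–Werner 2001 (Acta Math. 187), §1, the display following
Theorem 1 (`ζ₂ = 5/8`, Theorem 1 with `n = 2`, combined with Lawler 1996, EJP 1:13, Thm 1.3, the
random-walk estimate up to constants):** "if `S` and `S'` denote two independent simple random
walks started from neighboring vertices in `ℤ²`, then for some constant `c > 0`,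
`c⁻¹ k^{-5/8} ≤ P[S[0,k] ∩ S'[0,k] = ∅] ≤ c k^{-5/8}` for all `k ≥ 1`." Here the probability
is written as `#{non-intersecting pairs of k-step walks from 0 and e₁} / 16^k`. Grounds (as the
printed exponent input, not as an equivalent) `Summit.CriticalPhenomena.SAWScalingLimit.Theses.SAWCutPointCondensation.FreeEnergyScaling`
and the window calibration of `…SAWCutPointCondensation.CutPointWindowLimit`.
[cite: LawlerSchrammWerner2001PlaneExponents, Thm 1 and §1 (display after Thm 1)]
[cite: Lawler1996CutTimes, Thm 1.3] -/
def LSW2001_srw_nonIntersection_five_eighths : Prop :=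
  ∃ c : ℝ, 0 < c ∧ ∀ k : ℕ, 1 ≤ k →
    c⁻¹ * (k : ℝ) ^ (-(5 / 8 : ℝ)) ≤ (nonIntersectingPairs k : ℝ) / 16 ^ k ∧
      (nonIntersectingPairs k : ℝ) / 16 ^ k ≤ c * (k : ℝ) ^ (-(5 / 8 : ℝ))

end Literature.Probability.RandomPlanarGeometry

end
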